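import Mathlib
import HarnessLib
import Summits.ResolutionOfSingularities.ResolutionOfSingularities.Theorems.WildQuotientsWildQuotientResolutionS1aKillFreeKN

/-!
# S1a — K-FREE FRAME: REFINEMENT nodes (`NodeAtlasData.adjoin`, `treeF_one_of_principalChart`)

[OURS · L1 W4.5c · lead-1 g11; A-KF v0 (O4) «refinement is necessary», R-F14 (`TreeF` refinement node), ASSIGNMENT v10.34 «(M) refinement tool»] — NOT
statements of the manuscript; counted 0; AI-level work, weaker than expert review. Crux stmt-ResolutionOfSingularities-17941 `CyclicQuotientFourfolds`, line
`s1a-logminvertex` v12 (`stub_reachLowerInF`).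

A REFINEMENT node of `TreeF` replaces the atlas `𝔄` of a decorated model `(M, 𝔄)` by a larger one. Adjoining ONE chart `(O⁺, D⁺)` (`NodeAtlasData.adjoin`)
shrinks the carried formal locus to `F_𝔄 ∩ {u | u ∈ O⁺ → ¬ PrincipalNear D⁺ u}` (`mem_fLocus_adjoin_iff`); if `D⁺` is principal near EVERY point of `O⁺` (the
Laurent chart of `…S1aMultGoodNode.principalNear_laurent` at a multiplicative point, or a killed chart) then `F_{𝔄⁺} = F_𝔄 ∖ O⁺` EXACTLY
(`fLocus_adjoin_of_forall`), and if `O⁺` meets a TOP-dimensional component of `F_𝔄` the refinement ALONE lowers `μ_F` (`lexLTF_of_fLocus_eq_diff`, via the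
embedding `F_𝔄 ∖ O⁺ ↪ F_𝔄` whose closed range misses an open part of the top component): `treeF_one_of_principalChart`.

* `NodeAtlasData.adjoin`, `adjoin_O_none/some`, `mem_fLocus_adjoin_iff`, `fLocus_adjoin_subset`, `fLocus_adjoin_of_forall`;
* `GModel.lexLTF_of_isEmbedding_not_subset_closure` (the measure lemma behind p655181/p656845, isolated), `lexLTF_of_fLocus_eq_diff`, `treeF_succ_of_refine`;
* ★★ `treeF_one_of_principalChart` / `treeF_one_of_principalChart'` (class `P` named on the adjoined atlas / on every atlas with formal locus `F_𝔄 ∖ O⁺`).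
-/

set_option linter.dupNamespace false

noncomputable section

open CategoryTheory Limits AlgebraicGeometry TopologicalSpace Topology
open Literature.AlgebraicGeometry.Resolution Literature.AlgebraicGeometry.RelativeSpec
open Summit.ResolutionOfSingularities.ResolutionOfSingularities.Theorems.WildQuotientResolution.S1
open Summit.ResolutionOfSingularities.ResolutionOfSingularities.Theorems.WildQuotientResolution.S1.NodeAtlas
open Summit.ResolutionOfSingularities.ResolutionOfSingularities.Theorems.WildQuotientResolution.S1.NpFrame

universe u

/-! ## Adjoining one chart to an atlas -/

namespace Summit.ResolutionOfSingularities.ResolutionOfSingularities.Theorems.WildQuotientResolution.S1.NpFrame.NodeAtlasData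

variable {p : ℕ} {V Y : Scheme.{u}} {q : V ⟶ Y} {G : Type u} [Group G] {ρ : ActionOver q G} {g₀ : G} (𝔄 : NodeAtlasData p ρ g₀)
  (O' : ρ.StableAffineOpens) (D' : NodeData p ρ g₀ O')

/-- **Adjoin one chart** `(O⁺, D⁺)` to the atlas (index type `Option ι`, `none ↦` the new chart). [OURS · L1 W4.5c · refinement] -/
def adjoin : NodeAtlasData p ρ g₀ where
  ι := Option 𝔄.ι
  O := fun i => Option.elim i O' 𝔄.O
  D := fun i => match i with
    | none => D'
    | some i => 𝔄.D i
  cover := fun v => by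
    obtain ⟨i, hi⟩ := 𝔄.cover v
    exact ⟨some i, hi⟩

/-- The new chart. -/
@[simp] theorem adjoin_O_none : (𝔄.adjoin O' D').O none = O' := rfl

/-- The old charts. -/
@[simp] theorem adjoin_O_some (i : 𝔄.ι) : (𝔄.adjoin O' D').O (some i) = 𝔄.O i := rfl

/-- ★ **The carried formal locus after adjoining**: `F_{𝔄⁺} = F_𝔄 ∩ {u | u ∈ O⁺ → ¬ PrincipalNear D⁺ u}`. -/
theorem mem_fLocus_adjoin_iff (u : V) : u ∈ (𝔄.adjoin O' D').fLocus ↔ u ∈ 𝔄.fLocus ∧ (u ∈ O'.1 → ¬ D'.PrincipalNear u) := by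
  rw [mem_fLocus_iff, mem_fLocus_iff]
  constructor
  · intro h
    exact ⟨fun i hi => h (some i) hi, fun hu => h none hu⟩
  · rintro ⟨h, h'⟩ (_ | i) hi
    · exact h' hi
    · exact h i hi

/-- Adjoining shrinks the carried formal locus. -/
theorem fLocus_adjoin_subset : (𝔄.adjoin O' D').fLocus ⊆ 𝔄.fLocus := fun u hu => ((𝔄.mem_fLocus_adjoin_iff O' D' u).mp hu).1

/-- ★ **A chart principal near EVERY point of itself deletes exactly its open**: `F_{𝔄⁺} = F_𝔄 ∖ O⁺`. -/
theorem fLocus_adjoin_of_forall (hall : ∀ u ∈ O'.1, D'.PrincipalNear u) : (𝔄.adjoin O' D').fLocus = 𝔄.fLocus \ (O'.1 : Set V) := by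
  ext u
  rw [mem_fLocus_adjoin_iff, Set.mem_sdiff]
  constructor
  · rintro ⟨h, h'⟩
    exact ⟨h, fun hu => h' hu (hall u hu)⟩
  · rintro ⟨h, h'⟩
    exact ⟨h, fun hu => absurd hu h'⟩

end Summit.ResolutionOfSingularities.ResolutionOfSingularities.Theorems.WildQuotientResolution.S1.NpFrame.NodeAtlasData

/-! ## Refinement nodes of `TreeF` -/

namespace Summit.ResolutionOfSingularities.ResolutionOfSingularities.Theorems.WildQuotientResolution.S1.GameFrame.GModel

variable {p : ℕ} {X' X₁ : Scheme.{0}} {q : X' ⟶ X₁} {G : Type} [Group G] {ρ : G →* Aut X'} {g₀ : G}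

/-- **The measure lemma, isolated**: an embedding `ψ : F_𝔅 → F_𝔄` whose range's CLOSURE does not contain a TOP-dimensional component `t` of `F_𝔄` forces
`LexLTF N 𝔅 M 𝔄` (`M` compact, `dim F_𝔄` finite). [OURS · L1 W4.5c] -/
theorem lexLTF_of_isEmbedding_not_subset_closure (N : GModel p q G ρ g₀) (𝔅 : NodeAtlasData p N.act g₀) (M : GModel p q G ρ g₀) [CompactSpace M.V]
    (𝔄 : NodeAtlasData p M.act g₀) {n : ℕ} (hdim : M.fdim 𝔄 < n) (ψ : ↥𝔅.fLocus → ↥𝔄.fLocus) (hψ : IsEmbedding ψ)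
    {t : Set ↥𝔄.fLocus} (ht : t ∈ irreducibleComponents ↥𝔄.fLocus) (hdt : topologicalKrullDim ↥t = M.fdim 𝔄) (htr : ¬ t ⊆ closure (Set.range ψ)) :
    LexLTF N 𝔅 M 𝔄 := by
  have hle : N.fdim 𝔅 ≤ M.fdim 𝔄 := hψ.isInducing.topologicalKrullDim_le
  rcases hle.lt_or_eq with hlt | heq
  · exact Or.inl hlt
  have hbot : M.fdim 𝔄 ≠ ⊥ := by
    intro hbot
    rw [fdim, topologicalKrullDim, Order.krullDim_eq_bot_iff] at hbot
    obtain ⟨x, -⟩ := ht.1.nonempty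
    exact hbot.elim ⟨closure {x}, isIrreducible_singleton.closure, isClosed_closure⟩
  obtain ⟨k, hk⟩ := exists_nat_eq_of_ne_bot_of_lt hbot hdim
  exact Or.inr ⟨heq, Or.inl (TopCount.nTopComp_lt_of_isEmbedding_of_not_subset_closure hψ hk (heq.trans hk)
    (M.finite_irreducibleComponents_fLocus 𝔄) ht (hdt.trans hk) htr)⟩

/-- ★ **A refinement deleting an OPEN set that meets a top component lowers `μ_F`**: `F_{𝔄⁺} = F_𝔄 ∖ U`, `U` open meeting a top-dimensional component of
`F_𝔄` ⇒ `LexLTF M 𝔄⁺ M 𝔄`. [OURS · L1 W4.5c · refinement] -/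
theorem lexLTF_of_fLocus_eq_diff (M : GModel p q G ρ g₀) [CompactSpace M.V] (𝔄 𝔄' : NodeAtlasData p M.act g₀) {n : ℕ} (hdim : M.fdim 𝔄 < n)
    {U : Set M.V} (hU : IsOpen U) (hF : 𝔄'.fLocus = 𝔄.fLocus \ U)
    {t : Set ↥𝔄.fLocus} (ht : t ∈ irreducibleComponents ↥𝔄.fLocus) (hdt : topologicalKrullDim ↥t = M.fdim 𝔄) (htouch : ∃ x ∈ t, (x : M.V) ∈ U) :
    LexLTF M 𝔄' M 𝔄 := by
  have hsub : 𝔄'.fLocus ⊆ 𝔄.fLocus := by rw [hF]; exact Set.sdiff_subset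
  refine M.lexLTF_of_isEmbedding_not_subset_closure 𝔄' M 𝔄 hdim (Set.inclusion hsub) (Topology.IsEmbedding.inclusion hsub) ht hdt fun htr => ?_
  obtain ⟨x, hxt, hxU⟩ := htouch
  -- the range `{z | z ∉ U}` is closed in `F_𝔄`
  have hrange : Set.range (Set.inclusion hsub) ⊆ {z : ↥𝔄.fLocus | (z : M.V) ∉ U} := by
    rintro _ ⟨z, rfl⟩
    have hz : (z : M.V) ∈ 𝔄.fLocus \ U := hF ▸ z.2
    exact hz.2
  have hclosed : IsClosed {z : ↥𝔄.fLocus | (z : M.V) ∉ U} := hU.isClosed_compl.preimage continuous_subtype_val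
  exact (htr.trans (closure_minimal hrange hclosed)) hxt hxU

/-- **A refinement node of `TreeF`**, by definition. -/
theorem treeF_succ_of_refine {P Q : ∀ N : GModel p q G ρ g₀, NodeAtlasData p N.act g₀ → Prop} (M : GModel p q G ρ g₀) (𝔄 𝔄' : NodeAtlasData p M.act g₀)
    {n : ℕ} (hP : P M 𝔄') (h : TreeF P Q n M 𝔄') : TreeF P Q (n + 1) M 𝔄 :=
  Or.inr (Or.inl ⟨𝔄', hP, h⟩)

/-- ★★ **ADJOINING AN EVERYWHERE-PRINCIPAL CHART THAT MEETS A TOP COMPONENT IS A `μ_F`-LOWERING REFINEMENT NODE.** `(O⁺, D⁺)` node data principal near every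
point of `O⁺` (e.g. the Laurent chart at a multiplicative point), `O⁺` meeting a top-dimensional component of `F_𝔄`, `P M (𝔄.adjoin O⁺ D⁺)` ⇒
`TreeF P (LexLTF · · M 𝔄) 1 M 𝔄`. [OURS · L1 W4.5c · A-KF v0 (O4)/(R)] -/
theorem treeF_one_of_principalChart {P : ∀ N : GModel p q G ρ g₀, NodeAtlasData p N.act g₀ → Prop} (M : GModel p q G ρ g₀) [CompactSpace M.V]
    (𝔄 : NodeAtlasData p M.act g₀) {n : ℕ} (hdim : M.fdim 𝔄 < n) (O' : M.act.StableAffineOpens) (D' : NodeData p M.act g₀ O')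
    (hall : ∀ u ∈ O'.1, D'.PrincipalNear u) (hP : P M (𝔄.adjoin O' D'))
    {t : Set ↥𝔄.fLocus} (ht : t ∈ irreducibleComponents ↥𝔄.fLocus) (hdt : topologicalKrullDim ↥t = M.fdim 𝔄) (htouch : ∃ x ∈ t, (x : M.V) ∈ O'.1) :
    TreeF P (fun N 𝔅 => LexLTF N 𝔅 M 𝔄) 1 M 𝔄 :=
  M.treeF_succ_of_refine 𝔄 _ hP
    (M.lexLTF_of_fLocus_eq_diff 𝔄 _ hdim (O'.1).isOpen (𝔄.fLocus_adjoin_of_forall O' D' hall) ht hdt htouch)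

/-- ★★ The same with `P` accepting EVERY atlas whose carried formal locus is `F_𝔄 ∖ O⁺` (a class depending on the atlas only through its formal locus). -/
theorem treeF_one_of_principalChart' {P : ∀ N : GModel p q G ρ g₀, NodeAtlasData p N.act g₀ → Prop} (M : GModel p q G ρ g₀) [CompactSpace M.V]
    (𝔄 : NodeAtlasData p M.act g₀) {n : ℕ} (hdim : M.fdim 𝔄 < n) (O' : M.act.StableAffineOpens) (D' : NodeData p M.act g₀ O')
    (hall : ∀ u ∈ O'.1, D'.PrincipalNear u) (hP : ∀ 𝔄' : NodeAtlasData p M.act g₀, 𝔄'.fLocus = 𝔄.fLocus \ (O'.1 : Set M.V) → P M 𝔄')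
    {t : Set ↥𝔄.fLocus} (ht : t ∈ irreducibleComponents ↥𝔄.fLocus) (hdt : topologicalKrullDim ↥t = M.fdim 𝔄) (htouch : ∃ x ∈ t, (x : M.V) ∈ O'.1) :
    TreeF P (fun N 𝔅 => LexLTF N 𝔅 M 𝔄) 1 M 𝔄 :=
  M.treeF_one_of_principalChart 𝔄 hdim O' D' hall (hP _ (𝔄.fLocus_adjoin_of_forall O' D' hall)) ht hdt htouch

end Summit.ResolutionOfSingularities.ResolutionOfSingularities.Theorems.WildQuotientResolution.S1.GameFrame.GModel

end
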